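import Literature.Probability.LatticeModels.DiscreteGFFMarkov
import Literature.Probability.LatticeModels.SharpnessProofs
import HarnessLib

/-!
# The Dirichlet Green functions of boxes converge to the Green function of `ℤ^d` (`d ≥ 3`)

Topic `Literature/Probability/LatticeModels`; companion of `DirichletGreenFunction.lean`
(`dirichletGreen`, `poissonKernel`, `green_representation`) and `DiscreteGFFMarkov.lean`
(`half_latticeGreen_eq_dirichletGreen_add_sum`:
`G(x - y) = G_Λ(x,y) + ∑_{z ∈ ∂Λ} H_Λ(x,z) G(z - y)` for `x ∈ Λ`, `G = latticeGreen / 2`). We prove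

* `tendsto_dirichletGreen_box` — `G_{Λ_n}(x,y) → G(x - y)` along the boxes `Λ_n = [-n,n]^d`: the
  difference is a convex combination (`H ≥ 0`, `∑ H = 1`) of values of `G` on `∂Λ_n`, which tend
  to `0` (`tendsto_latticeGreen_cofinite`). This is the convergence of the covariances of the
  finite-volume free fields to that of the free field of `ℤ^d` in the last paragraph of the proof
  of Lupu 2016, Prop. 4.2 (used by the proof of `Lupu2016_cableSignClustersBounded`).

References: Lawler 1991, §1.5 (`Lawler1991`); Lupu, Ann. Probab. 44 (2016), proof of Prop. 4.2
(`Lupu2016`). (`SharpnessProofs` is imported only for `eventually_mem_box`.)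
-/

noncomputable section

namespace Literature.Probability.LatticeModels

open Finset Filter _root_.Topology

variable {d : ℕ}

/-! ### Convergence of the Dirichlet Green functions of boxes -/

variable (d) in
/-- **`G_{Λ_n}(x,y) → G(x - y)`** as `n → ∞` along the boxes `Λ_n = [-n,n]^d` (`d ≥ 3`,
`G = latticeGreen / 2`): by `half_latticeGreen_eq_dirichletGreen_add_sum` the difference is
`∑_z H_{Λ_n}(x,z) G(z - y)`,
a convex combination (`H ≥ 0`, `∑ H = 1`) of values of `G` on `∂Λ_n`, which tend to `0`
(`tendsto_latticeGreen_cofinite`). This is the convergence of the covariances of the finite-volume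
free fields to the covariance of the free field of `ℤ^d` used in the last paragraph of the proof
of Lupu 2016, Prop. 4.2. [cite: Lupu2016, proof of Prop. 4.2] -/
theorem tendsto_dirichletGreen_box (hd : 3 ≤ d) (x y : Site d) :
    Tendsto (fun n : ℕ => dirichletGreen (box d n) x y) atTop (𝓝 (latticeGreen (x - y) / 2)) := by
  have hd1 : 0 < d := by omega
  rw [Metric.tendsto_nhds]
  intro ε hε
  -- the finitely many sites where `|G/2| ≥ ε/2` lie in a box around `y`
  have hfin : {w : Site d | ε / 2 ≤ |latticeGreen w / 2|}.Finite := by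
    have hG : Tendsto (fun w : Site d => latticeGreen w / 2) cofinite (𝓝 0) := by
      simpa using (tendsto_latticeGreen_cofinite d hd).div_const 2
    have h : (fun w : Site d => latticeGreen w / 2) ⁻¹' Metric.ball 0 (ε / 2) ∈ cofinite :=
      hG (Metric.ball_mem_nhds 0 (half_pos hε))
    refine (Filter.mem_cofinite.1 h).subset fun w hw => ?_
    have hw' : ε / 2 ≤ |latticeGreen w / 2| := hw
    simp only [Set.mem_compl_iff, Set.mem_preimage, Metric.mem_ball, Real.dist_eq, sub_zero,
      not_lt]
    exact hw'
  have hbad : ∀ᶠ n : ℕ in atTop, ∀ w ∈ hfin.toFinset, w + y ∈ box d n := by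
    refine (hfin.toFinset.eventually_all).2 fun w _ => eventually_mem_box (w + y)
  filter_upwards [eventually_mem_box x, hbad] with n hxn hbn
  rw [Real.dist_eq]
  have key := half_latticeGreen_eq_dirichletGreen_add_sum hd (box d n) hxn y
  have hdiff : dirichletGreen (box d n) x y - latticeGreen (x - y) / 2 =
      -∑ z ∈ outerBoundary (zdGraph d) (box d n),
        poissonKernel (box d n) x z * (latticeGreen (z - y) / 2) := by
    rw [key]; ring
  rw [hdiff, abs_neg]
  -- each boundary value is `< ε/2` in absolute value
  have hsmall : ∀ z ∈ outerBoundary (zdGraph d) (box d n),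
      |latticeGreen (z - y) / 2| < ε / 2 := by
    intro z hz
    have hzn : z ∉ box d n := (mem_outerBoundary_iff.1 hz).1
    by_contra hge
    have hmem : z - y ∈ hfin.toFinset := by
      rw [Set.Finite.mem_toFinset]
      exact not_lt.1 hge
    exact hzn (by simpa using hbn (z - y) hmem)
  calc |∑ z ∈ outerBoundary (zdGraph d) (box d n),
          poissonKernel (box d n) x z * (latticeGreen (z - y) / 2)|
      ≤ ∑ z ∈ outerBoundary (zdGraph d) (box d n),
          |poissonKernel (box d n) x z * (latticeGreen (z - y) / 2)| := abs_sum_le_sum_abs _ _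
    _ = ∑ z ∈ outerBoundary (zdGraph d) (box d n),
          poissonKernel (box d n) x z * |latticeGreen (z - y) / 2| := by
        refine Finset.sum_congr rfl fun z _ => ?_
        rw [abs_mul, abs_of_nonneg (poissonKernel_nonneg hd1 _ x z)]
    _ ≤ ∑ z ∈ outerBoundary (zdGraph d) (box d n), poissonKernel (box d n) x z * (ε / 2) :=
        Finset.sum_le_sum fun z hz =>
          mul_le_mul_of_nonneg_left (hsmall z hz).le (poissonKernel_nonneg hd1 _ x z)
    _ = ε / 2 := by rw [← Finset.sum_mul, sum_poissonKernel hd1 _ hxn, one_mul]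
    _ < ε := half_lt_self hε

end Literature.Probability.LatticeModels
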